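import Literature.NumberTheory.LFunctions.Zhang2022.DetectorShiftLeadingCoeff
import Literature.NumberTheory.LFunctions.Zhang2022.DetectorShiftMomentsDD

/-!
# Zhang (2022), programme F-S3 (cell landau-siegel §E, seat ls-barrier-p6, piece [K2a] of the DOUBLING plan):
# SOLVABILITY of the clamped interpolation problem — the 4×4 determinant of the Euler–Lagrange exponentials
# `{1, e^{−iπb₀y}, e^{−iπb₁y}, e^{−iπb₂y}}` clamped at `y = −1` with data at `y = 0` equals
# `π²·D(b)`, and `D(b) = 2·e^{iπB}·Vdm(b)·c₀(b)` with `c₀(b) = Re Σ_j W_j(b)` — hence non-zero wherever `c₀ ≠ 0`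

Y. Zhang, *Discrete mean estimates and the Landau–Siegel zero*, arXiv:2211.02515v1 [Zhang2022LandauSiegel] —
an unrefereed manuscript under adjudication. **WHAT THIS IS NOT: not a claim about Theorems 1–2 of
arXiv:2211.02515, about Landau–Siegel zeros, or about Parity; nothing here asserts any claim of the manuscript.
The programme SEARCHES and TYPES; no claim about Landau–Siegel zeros, Theorems 1–2 of arXiv:2211.02515 or a
repaired Margin232 until a kernel theorem says so.**

Context (cell documents barrier/num/H-CLOSED-FORM.md §10 «doubling», barrier/p6/RESONANT-PLANE.md, INBOX
2026-08-27T01:45Z/01:51Z; the kernel plan of record for the E-010(ii) continuum, head 2 of registry row E-102):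
the one-sided recipe form `(π/2)·𝔅_{R(b)}(g) = c₀(b)·T_b^{[0,1]}(S) + x₀*·Bdm(b)·x₀` (`S = ∫_y^1 g`, `x₀ = (S(0), S′(0))`)
is DOUBLED by continuing `S` to `[−1, 0]` with the Euler–Lagrange exponential sum
`S_L = γ₀ + Σ_m γ_m e^{−iπb_m y}` CLAMPED at `y = −1` and matching `(S_L, S_L′)(0) = x₀` (piece K2: its bulk energy is
`x₀*·Bdm·x₀/c₀`), after which a full-circle Parseval (K3) exhibits `𝔅` as `c₀·Σ_{m∈ℤ} σ_b(m)|ĉ_m|²`, non-negative for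
sign-admissible `b` by the lattice lemma (K4). THIS FILE is the solvability input of K2: the interpolation conditions
form the linear system with matrix (rows `e(−1), e′(−1), e(0), e′(0)`, columns `e₀ = 1, e_m = e^{−iπb_m y}`)

  `M(b) = [[1, z₀, z₁, z₂], [0, −iπb₀z₀, −iπb₁z₁, −iπb₂z₂], [1, 1, 1, 1], [0, −iπb₀, −iπb₁, −iπb₂]]`, `z_m = e^{iπb_m}`,

whose determinant is `π²·D(b)` with the 12-term polynomial
  `D(b) = Det.doublingDet b := b₀b₂(z₁−1)(z₀−z₂) − b₁b₂(z₀−1)(z₁−z₂) − b₀b₁(z₂−1)(z₀−z₁)` (`doublingDet_eq_expanded`;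
  subtract row `e(0)` from row `e(−1)` and expand along the first column — the cofactor computation is recorded in the
  cell's CAS note hform/region/CRAMER-DATA.txt («det M = π²·N»); this file works with `D(b)` directly). Theorems:
* **`doublingDet_eq_re_sum_shiftW`** — for pairwise distinct `b`:
  `D(b) = 2·e^{iπB}·(b₀−b₁)(b₀−b₂)(b₁−b₂)·c₀(b)`, `B = (b₀+b₁+b₂)/2`, `c₀(b) = Re Σ_j W_j(b)` (the recipe weights
  `Det.shiftW`; cell identity «D2 / Id-3», two-lineage exact there, here a theorem): because
  `e^{iπB}·W_j = b_j z_k z_l/v_j`, `e^{iπB}·conj W_j = b_j z_j/v_j` and `Vdm/v_j = ±(b_k − b_l)`;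
* `doublingDet_ne_zero` (`c₀(b) ≠ 0 ⇒ D(b) ≠ 0`) and `doublingDet_ne_zero_of_signAdmissible` (by
  `Det.re_sum_shiftW_pos`, p478269): the clamped interpolation is uniquely solvable for EVERY sign-admissible shift
  triple — the matching step of the doubling chain never degenerates on the §E class.

Elementary algebra; one definition (`doublingDet`, explicit parameters, no `Prop`); standard axioms; no numerics.

References: Y. Zhang, arXiv:2211.02515v1 (2022), Prop. 7.1 p. 44 with (7.19)–(7.21), §8 (8.11)–(8.18); §2 Lemma 2.3.
[cite: Zhang2022LandauSiegel, proof of Prop 7.1 p. 44, (7.19)–(7.21)]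
-/

noncomputable section

open Complex Real ComplexConjugate

namespace Literature.NumberTheory.LFunctions.Zhang2022

namespace Det

/-- **The doubling determinant** `D(b) = b₀b₂(z₁−1)(z₀−z₂) − b₁b₂(z₀−1)(z₁−z₂) − b₀b₁(z₂−1)(z₀−z₁)`,
`z_m = e^{iπb_m}`: `π⁻²` times the determinant of the clamped interpolation matrix of the Euler–Lagrange exponentials
of the recipe `Det.shiftRecipe b` (cell CAS note CRAMER-DATA.txt: `det M = π²·D`). [cite: Zhang2022LandauSiegel, proof of Prop 7.1 p. 44, (7.19)–(7.21)] -/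
def doublingDet (b : Fin 3 → ℝ) : ℂ :=
  (b 0 * b 2 : ℂ) * (cexp (I * π * b 1) - 1) * (cexp (I * π * b 0) - cexp (I * π * b 2))
    - (b 1 * b 2 : ℂ) * (cexp (I * π * b 0) - 1) * (cexp (I * π * b 1) - cexp (I * π * b 2))
    - (b 0 * b 1 : ℂ) * (cexp (I * π * b 2) - 1) * (cexp (I * π * b 0) - cexp (I * π * b 1))

variable (b : Fin 3 → ℝ)

/-- The expanded 12-term form of `D(b)` (the cell's polynomial `Q`/`N` of CRAMER-DATA.txt, tree indexing).
[cite: Zhang2022LandauSiegel, proof of Prop 7.1 p. 44, (7.19)–(7.21)] -/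
theorem doublingDet_eq_expanded :
    doublingDet b
      = -(b 0 * b 1 : ℂ) * cexp (I * π * b 0) * cexp (I * π * b 2) + (b 0 * b 1 : ℂ) * cexp (I * π * b 0)
        + (b 0 * b 1 : ℂ) * cexp (I * π * b 1) * cexp (I * π * b 2) - (b 0 * b 1 : ℂ) * cexp (I * π * b 1)
        + (b 0 * b 2 : ℂ) * cexp (I * π * b 0) * cexp (I * π * b 1) - (b 0 * b 2 : ℂ) * cexp (I * π * b 0)
        - (b 0 * b 2 : ℂ) * cexp (I * π * b 1) * cexp (I * π * b 2) + (b 0 * b 2 : ℂ) * cexp (I * π * b 2)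
        - (b 1 * b 2 : ℂ) * cexp (I * π * b 0) * cexp (I * π * b 1) + (b 1 * b 2 : ℂ) * cexp (I * π * b 0) * cexp (I * π * b 2)
        + (b 1 * b 2 : ℂ) * cexp (I * π * b 1) - (b 1 * b 2 : ℂ) * cexp (I * π * b 2) := by
  unfold doublingDet
  ring

variable {b}

/-- The Vandermonde denominators of `Det.shiftW` are non-zero for a pairwise distinct triple. [cite: Zhang2022LandauSiegel, proof of Prop 7.1, (7.19)–(7.20)] -/
theorem shiftVdm_ne_zero_of_injective (hb : Function.Injective b) (j : Fin 3) : shiftVdm b j ≠ 0 := by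
  have h01 : b 0 ≠ b 1 := fun h => by have := hb h; exact absurd this (by decide)
  have h02 : b 0 ≠ b 2 := fun h => by have := hb h; exact absurd this (by decide)
  have h12 : b 1 ≠ b 2 := fun h => by have := hb h; exact absurd this (by decide)
  fin_cases j
  · simp only [shiftVdm, Fin.zero_eta, Matrix.cons_val_zero]
    exact mul_ne_zero (sub_ne_zero.2 (Ne.symm h01)) (sub_ne_zero.2 (Ne.symm h02))
  · simp only [shiftVdm, Fin.mk_one, Matrix.cons_val_one, Matrix.cons_val_zero]
    exact mul_ne_zero (sub_ne_zero.2 (Ne.symm h12)) (sub_ne_zero.2 h01)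
  · simp only [shiftVdm, Fin.reduceFinMk, Matrix.cons_val_two, Matrix.tail_cons, Matrix.head_cons]
    exact mul_ne_zero (sub_ne_zero.2 h02) (sub_ne_zero.2 h12)

/-- `e^{iπB}·W_j(b) = b_j·e^{iπs_j}/v_j` (`s_j = Σ_{i≠j} b_i`, so `e^{iπs_j} = z_k z_l`): the phase of the weight
times `e^{iπB}` is the product of the OTHER two `z`'s. [cite: Zhang2022LandauSiegel, proof of Prop 7.1, (7.19)–(7.21)] -/
theorem cexp_shiftB_mul_shiftW (b : Fin 3 → ℝ) (j : Fin 3) :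
    cexp (I * π * shiftB b) * shiftW b j = (b j : ℂ) * cexp (I * π * shiftS b j) / (shiftVdm b j : ℂ) := by
  unfold shiftW
  rw [mul_div_assoc', mul_left_comm, ← Complex.exp_add]
  congr 2
  rw [show I * π * (((shiftS b j - b j) / 2 : ℝ) : ℂ) = I * π * ((shiftB b - b j : ℝ) : ℂ) by
    rw [shiftS_sub_div_two]]
  have : (shiftS b j : ℝ) = 2 * shiftB b - b j := by
    fin_cases j <;> simp [shiftS, shiftB] <;> ring
  rw [this]
  push_cast
  ring

/-- `e^{iπB}·conj W_j(b) = b_j·z_j/v_j`. [cite: Zhang2022LandauSiegel, proof of Prop 7.1, (7.19)–(7.21)] -/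
theorem cexp_shiftB_mul_conj_shiftW (b : Fin 3 → ℝ) (j : Fin 3) :
    cexp (I * π * shiftB b) * conj (shiftW b j) = (b j : ℂ) * cexp (I * π * b j) / (shiftVdm b j : ℂ) := by
  unfold shiftW
  rw [map_div₀, map_mul, Complex.conj_ofReal, Complex.conj_ofReal, ← Complex.exp_conj, map_mul, map_mul,
    Complex.conj_I, Complex.conj_ofReal, Complex.conj_ofReal, mul_div_assoc', mul_left_comm, ← Complex.exp_add]
  congr 2
  rw [shiftS_sub_div_two]
  push_cast
  ring

/-- **D2: the doubling determinant is `2·e^{iπB}·Vdm(b)·c₀(b)`.** For a pairwise distinct real triple,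
`D(b) = 2·e^{iπB}·(b₀−b₁)(b₀−b₂)(b₁−b₂)·Re Σ_j W_j(b)` (`B = Det.shiftB b`; `c₀ = Re Σ_j shiftW b j`, the leading
coefficient of `DetectorShiftLeadingCoeff`). [cite: Zhang2022LandauSiegel, proof of Prop 7.1 p. 44, (7.19)–(7.21)] -/
theorem doublingDet_eq_re_sum_shiftW (hb : Function.Injective b) :
    doublingDet b
      = 2 * cexp (I * π * shiftB b) * (((b 0 - b 1) * (b 0 - b 2) * (b 1 - b 2) : ℝ) : ℂ)
          * (((∑ j : Fin 3, shiftW b j).re : ℝ) : ℂ) := by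
  -- 2 Re A₀ = A₀ + conj A₀
  have hre : (((∑ j : Fin 3, shiftW b j).re : ℝ) : ℂ) * 2
      = (∑ j : Fin 3, shiftW b j) + conj (∑ j : Fin 3, shiftW b j) := by
    rw [Complex.add_conj]; push_cast; ring
  have key : 2 * cexp (I * π * shiftB b) * (((∑ j : Fin 3, shiftW b j).re : ℝ) : ℂ)
      = ∑ j : Fin 3, ((b j : ℂ) * cexp (I * π * shiftS b j) / (shiftVdm b j : ℂ)
          + (b j : ℂ) * cexp (I * π * b j) / (shiftVdm b j : ℂ)) := by
    rw [show 2 * cexp (I * π * shiftB b) * (((∑ j : Fin 3, shiftW b j).re : ℝ) : ℂ)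
        = cexp (I * π * shiftB b) * ((((∑ j : Fin 3, shiftW b j).re : ℝ) : ℂ) * 2) by ring, hre, map_sum,
      mul_add, Finset.mul_sum, Finset.mul_sum, ← Finset.sum_add_distrib]
    refine Finset.sum_congr rfl fun j _ => ?_
    rw [cexp_shiftB_mul_shiftW, cexp_shiftB_mul_conj_shiftW]
  -- clear denominators and compare with the explicit polynomial
  have hv0 := shiftVdm_ne_zero_of_injective hb 0
  have hv1 := shiftVdm_ne_zero_of_injective hb 1
  have hv2 := shiftVdm_ne_zero_of_injective hb 2
  simp only [shiftVdm, Matrix.cons_val_zero, Matrix.cons_val_one, Matrix.cons_val_two, Matrix.head_cons,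
    Matrix.tail_cons] at hv0 hv1 hv2
  have hv0' : ((b 1 - b 0) * (b 2 - b 0) : ℂ) ≠ 0 := by exact_mod_cast hv0
  have hv1' : ((b 2 - b 1) * (b 0 - b 1) : ℂ) ≠ 0 := by exact_mod_cast hv1
  have hv2' : ((b 0 - b 2) * (b 1 - b 2) : ℂ) ≠ 0 := by exact_mod_cast hv2
  rw [show 2 * cexp (I * π * shiftB b) * (((b 0 - b 1) * (b 0 - b 2) * (b 1 - b 2) : ℝ) : ℂ)
        * (((∑ j : Fin 3, shiftW b j).re : ℝ) : ℂ)
      = (((b 0 - b 1) * (b 0 - b 2) * (b 1 - b 2) : ℝ) : ℂ)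
        * (2 * cexp (I * π * shiftB b) * (((∑ j : Fin 3, shiftW b j).re : ℝ) : ℂ)) by ring, key,
    Fin.sum_univ_three]
  simp only [shiftS, shiftVdm, Matrix.cons_val_zero, Matrix.cons_val_one, Matrix.cons_val_two, Matrix.head_cons,
    Matrix.tail_cons]
  push_cast
  rw [show I * π * ((b 1 : ℂ) + b 2) = I * π * b 1 + I * π * b 2 by ring,
    show I * π * ((b 2 : ℂ) + b 0) = I * π * b 2 + I * π * b 0 by ring,
    show I * π * ((b 0 : ℂ) + b 1) = I * π * b 0 + I * π * b 1 by ring,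
    Complex.exp_add, Complex.exp_add, Complex.exp_add]
  unfold doublingDet
  set z0 : ℂ := cexp (I * π * b 0) with hz0
  set z1 : ℂ := cexp (I * π * b 1) with hz1
  set z2 : ℂ := cexp (I * π * b 2) with hz2
  rw [div_add_div _ _ hv0' hv0', div_add_div _ _ hv1' hv1', div_add_div _ _ hv2' hv2',
    div_add_div _ _ (mul_ne_zero hv0' hv0') (mul_ne_zero hv1' hv1'),
    div_add_div _ _ (mul_ne_zero (mul_ne_zero hv0' hv0') (mul_ne_zero hv1' hv1')) (mul_ne_zero hv2' hv2'),
    ← mul_div_assoc,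
    eq_div_iff (mul_ne_zero (mul_ne_zero (mul_ne_zero hv0' hv0') (mul_ne_zero hv1' hv1')) (mul_ne_zero hv2' hv2'))]
  ring

/-- **Solvability:** if `c₀(b) ≠ 0` (pairwise distinct `b`) then `D(b) ≠ 0` — the clamped interpolation matrix is
invertible. [cite: Zhang2022LandauSiegel, proof of Prop 7.1 p. 44, (7.19)–(7.21)] -/
theorem doublingDet_ne_zero (hb : Function.Injective b) (hc : (∑ j : Fin 3, shiftW b j).re ≠ 0) :
    doublingDet b ≠ 0 := by
  rw [doublingDet_eq_re_sum_shiftW hb]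
  have h01 : b 0 ≠ b 1 := fun h => by have := hb h; exact absurd this (by decide)
  have h02 : b 0 ≠ b 2 := fun h => by have := hb h; exact absurd this (by decide)
  have h12 : b 1 ≠ b 2 := fun h => by have := hb h; exact absurd this (by decide)
  have hV : (((b 0 - b 1) * (b 0 - b 2) * (b 1 - b 2) : ℝ) : ℂ) ≠ 0 := by
    exact_mod_cast mul_ne_zero (mul_ne_zero (sub_ne_zero.2 h01) (sub_ne_zero.2 h02)) (sub_ne_zero.2 h12)
  have hc' : (((∑ j : Fin 3, shiftW b j).re : ℝ) : ℂ) ≠ 0 := by exact_mod_cast hc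
  exact mul_ne_zero (mul_ne_zero (mul_ne_zero two_ne_zero (Complex.exp_ne_zero _)) hV) hc'

/-- **Every sign-admissible shift triple has `D(b) ≠ 0`** (`c₀(b) > 0` by `Det.re_sum_shiftW_pos`): the doubling
interpolation is uniquely solvable on the whole §E class of `Repair.familyDetShift`.
[cite: Zhang2022LandauSiegel, §2 Lemma 2.3, (2.13); proof of Prop 7.1 (7.19)–(7.21)] -/
theorem doublingDet_ne_zero_of_signAdmissible (hb : SignAdmissible b) : doublingDet b ≠ 0 :=
  doublingDet_ne_zero hb.injective (re_sum_shiftW_pos hb).ne'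

/-- The same determinant at the printed triple: `D(1,2,3) = 16` (`z = (−1, 1, −1)`).
[cite: Zhang2022LandauSiegel, Prop 7.1 p. 44] -/
theorem doublingDet_std : doublingDet ![1, 2, 3] = 16 := by
  unfold doublingDet
  simp only [Matrix.cons_val_zero, Matrix.cons_val_one, Matrix.cons_val_two, Matrix.head_cons, Matrix.tail_cons]
  have h1 : cexp (I * π * ((1 : ℝ) : ℂ)) = -1 := by
    rw [show I * π * ((1 : ℝ) : ℂ) = π * I by push_cast; ring, Complex.exp_pi_mul_I]
  have h2 : cexp (I * π * ((2 : ℝ) : ℂ)) = 1 := by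
    rw [show I * π * ((2 : ℝ) : ℂ) = 2 * π * I by push_cast; ring, Complex.exp_two_pi_mul_I]
  have h3 : cexp (I * π * ((3 : ℝ) : ℂ)) = -1 := by
    rw [show I * π * ((3 : ℝ) : ℂ) = π * I + 2 * π * I by push_cast; ring, Complex.exp_add,
      Complex.exp_pi_mul_I, Complex.exp_two_pi_mul_I, mul_one]
  rw [h1, h2, h3]
  push_cast
  ring

/-! ### Part 2 — the 4×4 interpolation determinant itself (appended; asked for completeness by the K2a booking) -/

/-- `Fin.succAbove 2 2 = 3` in `Fin 4`. [folklore] -/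
private theorem succAbove_two_two : Fin.succAbove (2 : Fin 4) (2 : Fin 3) = 3 := by decide
/-- `Fin.succAbove 3 2 = 2` in `Fin 4`. [folklore] -/
private theorem succAbove_three_two : Fin.succAbove (3 : Fin 4) (2 : Fin 3) = 2 := by decide
/-- `Fin.succAbove 1 2 = 3` in `Fin 4`. [folklore] -/
private theorem succAbove_one_two : Fin.succAbove (1 : Fin 4) (2 : Fin 3) = 3 := by decide

/-- Leibniz expansion of a `4 × 4` determinant (same private helper as in
`Literature/AlgebraicGeometry/LineGeometry/KleinCorrespondence.lean`). [folklore] -/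
private theorem det_fin_four' {R : Type*} [CommRing R] (A : Matrix (Fin 4) (Fin 4) R) :
    A.det =
      A 0 0 * A 1 1 * A 2 2 * A 3 3 - A 0 0 * A 1 1 * A 2 3 * A 3 2
        - A 0 0 * A 1 2 * A 2 1 * A 3 3 + A 0 0 * A 1 2 * A 2 3 * A 3 1
        + A 0 0 * A 1 3 * A 2 1 * A 3 2 - A 0 0 * A 1 3 * A 2 2 * A 3 1
        - A 0 1 * A 1 0 * A 2 2 * A 3 3 + A 0 1 * A 1 0 * A 2 3 * A 3 2
        + A 0 1 * A 1 2 * A 2 0 * A 3 3 - A 0 1 * A 1 2 * A 2 3 * A 3 0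
        - A 0 1 * A 1 3 * A 2 0 * A 3 2 + A 0 1 * A 1 3 * A 2 2 * A 3 0
        + A 0 2 * A 1 0 * A 2 1 * A 3 3 - A 0 2 * A 1 0 * A 2 3 * A 3 1
        - A 0 2 * A 1 1 * A 2 0 * A 3 3 + A 0 2 * A 1 1 * A 2 3 * A 3 0
        + A 0 2 * A 1 3 * A 2 0 * A 3 1 - A 0 2 * A 1 3 * A 2 1 * A 3 0
        - A 0 3 * A 1 0 * A 2 1 * A 3 2 + A 0 3 * A 1 0 * A 2 2 * A 3 1
        + A 0 3 * A 1 1 * A 2 0 * A 3 2 - A 0 3 * A 1 1 * A 2 2 * A 3 0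
        - A 0 3 * A 1 2 * A 2 0 * A 3 1 + A 0 3 * A 1 2 * A 2 1 * A 3 0 := by
  rw [Matrix.det_succ_row_zero]
  simp [Fin.sum_univ_succ, Matrix.det_fin_three, succAbove_two_two, succAbove_three_two,
    succAbove_one_two]
  ring

/-- **The clamped interpolation determinant:** with rows `e(−1), e′(−1), e(0), e′(0)` and columns
`e₀ = 1, e_m = e^{−iπb_m y}` (`e_m(−1) = z_m = e^{iπb_m}`, `e_m′ = −iπb_m·e_m`), `det M(b) = π²·D(b)` — the cell's CAS
statement «det M = π²·N» (hform/region/CRAMER-DATA.txt) as a kernel theorem. [cite: Zhang2022LandauSiegel, proof of Prop 7.1 p. 44, (7.19)–(7.21)] -/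
theorem det_doublingMatrix (b : Fin 3 → ℝ) :
    Matrix.det !![(1 : ℂ), cexp (I * π * b 0), cexp (I * π * b 1), cexp (I * π * b 2);
        0, -(I * π * b 0) * cexp (I * π * b 0), -(I * π * b 1) * cexp (I * π * b 1), -(I * π * b 2) * cexp (I * π * b 2);
        1, 1, 1, 1;
        0, -(I * π * b 0), -(I * π * b 1), -(I * π * b 2)]
      = (π : ℂ) ^ 2 * doublingDet b := by
  rw [det_fin_four']
  simp only [Matrix.of_apply, Matrix.cons_val, Matrix.cons_val_zero, Matrix.cons_val_one]
  unfold doublingDet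
  set z0 : ℂ := cexp (I * π * b 0)
  set z1 : ℂ := cexp (I * π * b 1)
  set z2 : ℂ := cexp (I * π * b 2)
  linear_combination ((π : ℂ) ^ 2 * (-(b 0 * b 2 : ℂ) * (z1 - 1) * (z0 - z2)
    + (b 1 * b 2 : ℂ) * (z0 - 1) * (z1 - z2) + (b 0 * b 1 : ℂ) * (z2 - 1) * (z0 - z1))) * Complex.I_sq

/-- Hence the interpolation matrix is invertible (non-zero determinant) at every sign-admissible triple.
[cite: Zhang2022LandauSiegel, §2 Lemma 2.3, (2.13); proof of Prop 7.1 (7.19)–(7.21)] -/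
theorem det_doublingMatrix_ne_zero_of_signAdmissible {b : Fin 3 → ℝ} (hb : SignAdmissible b) :
    Matrix.det !![(1 : ℂ), cexp (I * π * b 0), cexp (I * π * b 1), cexp (I * π * b 2);
        0, -(I * π * b 0) * cexp (I * π * b 0), -(I * π * b 1) * cexp (I * π * b 1), -(I * π * b 2) * cexp (I * π * b 2);
        1, 1, 1, 1;
        0, -(I * π * b 0), -(I * π * b 1), -(I * π * b 2)] ≠ 0 := by
  rw [det_doublingMatrix]
  exact mul_ne_zero (pow_ne_zero 2 (by exact_mod_cast Real.pi_ne_zero)) (doublingDet_ne_zero_of_signAdmissible hb)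

end Det

end Literature.NumberTheory.LFunctions.Zhang2022
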